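import Mathlib
import Summits.Ventures.HodgeRepro2.T5HodgeStar
import Summits.Ventures.HodgeRepro2.T5TwoZeroPositivity

/-!
# T5PeriodConventions — the period as the L² product (H2.2) and the orientation convention (H4),
in the coframe model

Tier-5 support for sub-step N1 (Hodge-theoretic side; memo route/T5-N1-hodge-p6.md §H2.2 and §H4).
In the six-coefficient model of `T5HodgeStar` (a (2,0)-form is `α_s = a(s) dz₁∧dz₂`, `wedge γ δ`
is the coefficient of `Vol` in `γ ∧ δ`, `herm` the pointwise hermitian metric of Voisin (5.1), and
the integral against the volume measure `μ = Vol_S`):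

* `integral_wedge_eq_integral_herm`: Corollary H2.2, «∫_S α ∧ β̄ = (α, β)_{L²(S,h)} in the
  normalisation (5.1)», as the integral of the pointwise identity H2.1 (`wedge_conjC_twoZero`);
  `integral_wedge_conjC_hodgeStar`: the same for arbitrary 2-forms with the Hodge star,
  `∫_S γ ∧ \overline{*δ} = ∫_S (γ, δ)_s Vol` (Voisin Lemma 5.4 / p0105 l. 8 integrated);
* `integral_neg`, `neg_ne_zero_iff`: H4 — reversing the orientation of `S` changes the sign of
  every period (`∫ (−ρ) = −∫ ρ` for the coefficient `ρ` of a top form) and leaves «≠ 0» unchanged;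
* `integral_wedge_self_re_neg_of_reversed`: the complex orientation is the one for which
  `(α, α) > 0` for `α ≠ 0` — with the opposite orientation the same period has negative real part
  (`T5TwoZeroPositivity.integral_wedge_self_re_pos_iff` for the complex orientation).

Blind lane (cell pub-hodge-repro2): `import Mathlib` + own files, 0 sorry, standard axioms.
-/

namespace Summit.Ventures.HodgeRepro2.T5PeriodConventions

open MeasureTheory
open Summit.Ventures.HodgeRepro2.T5HodgeStar Summit.Ventures.HodgeRepro2.T5TwoZeroPositivity

variable {S : Type*} [MeasurableSpace S] {μ : Measure S}

/-- Corollary H2.2 in the model: `∫_S α ∧ β̄ = ∫_S (α, β)_s dVol_S` for (2,0)-forms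
`α = a dz₁∧dz₂`, `β = b dz₁∧dz₂` — the period is the L² inner product of Voisin (5.1). -/
theorem integral_wedge_eq_integral_herm (a b : S → ℂ) :
    ∫ s, wedge (twoZero (a s)) (conjC (twoZero (b s))) ∂μ =
      ∫ s, herm (twoZero (a s)) (twoZero (b s)) ∂μ := by
  simp only [wedge_conjC_twoZero]

/-- Voisin's `(α, β)_{L²} = ∫_X α ∧ \overline{*β}` (Lemma 5.4 with p0105 l. 8) for arbitrary complex
2-forms in the model: `∫_S γ ∧ \overline{*δ} = ∫_S (γ, δ)_s dVol_S`. -/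
theorem integral_wedge_conjC_hodgeStar (γ δ : S → TwoCovector) :
    ∫ s, wedge (γ s) (conjC (hodgeStar (δ s))) ∂μ = ∫ s, herm (γ s) (δ s) ∂μ := by
  simp only [wedge_conjC_hodgeStar]

/-- The explicit value: `∫_S α ∧ β̄ = 4 ∫_S a b̄ dVol_S` (`T5TwoZeroPositivity.integral_wedge`),
restated next to H2.2 — the constant `4 = ‖dz₁ ∧ dz₂‖²` of the memo's check. -/
theorem integral_herm_twoZero (a b : S → ℂ) :
    ∫ s, herm (twoZero (a s)) (twoZero (b s)) ∂μ = 4 * ∫ s, a s * (starRingEnd ℂ) (b s) ∂μ := by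
  rw [← integral_wedge_eq_integral_herm, integral_wedge]

/-- H4, first clause: the integral of a top form `ρ Vol` changes sign with the orientation —
`∫ (−ρ) dμ = −∫ ρ dμ` (Mathlib `integral_neg`). -/
theorem integral_neg_coeff (ρ : S → ℂ) : ∫ s, -ρ s ∂μ = -∫ s, ρ s ∂μ :=
  integral_neg ρ

/-- H4, second clause: reversing the orientation «leaves (N) (≠ 0) unchanged». -/
theorem neg_integral_ne_zero_iff (ρ : S → ℂ) : -∫ s, ρ s ∂μ ≠ 0 ↔ ∫ s, ρ s ∂μ ≠ 0 :=
  neg_ne_zero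

/-- The same for the period of two (2,0)-forms: `∫_S α ∧ β̄ ≠ 0` does not depend on the
orientation. -/
theorem neg_integral_wedge_ne_zero_iff (a b : S → ℂ) :
    -∫ s, wedge (twoZero (a s)) (conjC (twoZero (b s))) ∂μ ≠ 0 ↔
      ∫ s, wedge (twoZero (a s)) (conjC (twoZero (b s))) ∂μ ≠ 0 :=
  neg_ne_zero

section Orientation

variable [TopologicalSpace S] [OpensMeasurableSpace S] [CompactSpace S]
  [IsFiniteMeasureOnCompacts μ] [μ.IsOpenPosMeasure]

/-- H4: with the complex orientation `(α, α) = ∫_S α ∧ ᾱ` has positive real part for `α ≠ 0`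
(`T5TwoZeroPositivity`); with the opposite orientation the same period is `−∫_S α ∧ ᾱ`, of negative
real part.  So the complex orientation is characterised as the one making the period form positive
definite on (2,0)-forms. -/
theorem integral_wedge_self_re_neg_of_reversed {a : S → ℂ} (ha : Continuous a) (h : a ≠ 0) :
    (-∫ s, wedge (twoZero (a s)) (conjC (twoZero (a s))) ∂μ).re < 0 := by
  rw [Complex.neg_re, neg_lt_zero]
  exact (integral_wedge_self_re_pos_iff ha).mpr h

/-- The two orientations are distinguished by the sign of `(α, α)` for any single `α ≠ 0`:
positive for the complex orientation, negative for the reversed one. -/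
theorem orientation_dichotomy {a : S → ℂ} (ha : Continuous a) (h : a ≠ 0) :
    0 < (∫ s, wedge (twoZero (a s)) (conjC (twoZero (a s))) ∂μ).re ∧
      (-∫ s, wedge (twoZero (a s)) (conjC (twoZero (a s))) ∂μ).re < 0 :=
  ⟨(integral_wedge_self_re_pos_iff ha).mpr h, integral_wedge_self_re_neg_of_reversed ha h⟩

end Orientation

end Summit.Ventures.HodgeRepro2.T5PeriodConventions
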